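import Literature.Computability.AlgebraicComplexity.FSV18SuccinctGenerators
import Literature.Barriers.ValiantsHypothesis.AlgebraicNaturalProofs
import Summits.ValiantsHypothesis.ValiantsHypothesis.Theorems.BarrierLeverNPCorpusChainBDGILPrelims
import HarnessLib

/-!
# Crux `BarrierLever.SuccinctHittingSetsForVP` (stmt-ValiantsHypothesis-14610) — the N1 SUMMITS
# CONSUMER, occur bullet: depth-`D` occur-`k` FORMULA distinguishers are hit, MULTILINEAR FRAME,
# conditionally on the named fact `FSV2018_thm9_occur`

**What is proved (CONDITIONAL on `Literature.Computability.AlgebraicComplexity.FSV2018_thm9_occur`,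
FSV Thm. 9 / Cor. 49, bullet "depth-`O(1)` occur-`O(1)` formulas" — typed in
`FSV18SuccinctGenerators.lean`, whose residual is the single fact `FSV2018_thm48`; it does NOT close
the item).**

* `multilinearSPS_subset_smallCircuits_inter` — the bridge from FSV's succinct side to the tree's
  simple class: a multilinear `ΣΠΣ` formula of size `S` in `x_1, …, x_n` (FSV: affine forms, the
  forms under one product gate on pairwise disjoint variable sets) is a MULTILINEAR polynomial
  (`degreeOf ≤ 1` coordinatewise), hence of total degree `≤ n`, and has fan-in-two complexity
  `≤ S(4n+5)` (each affine form costs `≤ 4(n+1)` gates, `complexity_le_of_totalDegree_le_one`); so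
  `multilinearSPS ℂ n S ⊆ SmallCircuits ℂ n b ∩ multilinearSlice ℂ n` whenever `S(4n+5) ≤ n^b`.
* `isSuccinctHittingSet_occur (h : FSV2018_thm9_occur) (D k a)` : there are `b, n₀` with: for all
  `n ≥ n₀` and every size bound `s ≤ 2^{n^a}` (this covers the `poly(N) = 2^{O(n)}`-size regime of
  the `N = 2^n` multilinear coefficient variables, and more), the multilinear members of
  `SmallCircuits ℂ n b` are a succinct hitting set, in the frame `M = multilinearMonomials n`, for the
  distinguishers computed by size-`≤ s`, depth-`≤ D`, occur-`≤ k` formulas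
  (`occurClass ℂ (multilinearMonomials n) D k s`). FSV's `MultilinearSPSHits` delivers multilinear
  `ΣΠΣ` of width `(⌈log₂ s⌉ + n + 2)^c ≤ (n^a + n + 2)^c`, whence `b = 2((a+1)c + 2)`, `n₀ = 3`
  (`width_arith`).
* `not_isNaturalProof_occur (h) (D k a)` : consequently no such formula is an algebraically natural
  proof against `SmallCircuits ℂ n b' ∩ multilinearSlice ℂ n`, `b' ≥ b`, `n ≥ n₀` (FSV Def. 1 /
  Thm. 4).

HONEST FRAMING. This is a multilinear-frame SLICE toward the rung: the rung
`Theses.BarrierLever.SuccinctHittingSetsForVP` lives in the frame `H = degLEMonomials n` (degree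
`≤ n`, `N = binom(2n, n)` coefficient variables) and asks for ALL `poly(N)`-size distinguishers; the
frame `H = degLEMonomials` is NOT reached here (the restriction of a nonzero `degLE`-distinguisher to
the multilinear coordinates can vanish — dead end of record, no transfer attempted), the rung stays
OPEN, and `VP ≠ VNP` is NOT proved. The unconditional (primed) versions follow the minute the tree's
keystone `FSV2018_thm48_topFanIn_holds` lands, via `FSV2018_thm9_occur_of_thm48_topFanIn`
(`FSV18Thm9OfTopFanIn.lean`). Pattern of `BarrierLeverSuccinctHittingSetsForVPSpsk(Unconditional)`.

References: [ForbesShpilkaVolk2018] M. A. Forbes, A. Shpilka, B. L. Volk, Theory Comput. 14 (2018),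
Def. 1, Def. 3, Thm. 4, Thm. 9 (= ToC Thm. 1.10, bullet 6), Def. 45, Cor. 49 (= ToC Cor. 5.25).
-/

-- layout Summits/ValiantsHypothesis/ValiantsHypothesis forces the duplicated namespace component
set_option linter.dupNamespace false

noncomputable section

namespace Summit.ValiantsHypothesis.ValiantsHypothesis.Theorems.BarrierLever.SuccinctHittingSetsForVP

open Literature.Barriers.ValiantsHypothesis Literature.Computability.AlgebraicComplexity MvPolynomial
open Summit.ValiantsHypothesis.ValiantsHypothesis.Theorems.BarrierLever.NPCorpusChainBDGILPrelims

namespace Occur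

/-! ### The bridge: multilinear `ΣΠΣ` formulas are cheap multilinear polynomials -/

/-- A variable outside `vars ℓ` has `degreeOf = 0`. [folklore] -/
theorem degreeOf_eq_zero_of_notMem_vars {n : ℕ} {ℓ : MvPolynomial (Fin n) ℂ} {x : Fin n}
    (hx : x ∉ ℓ.vars) : degreeOf x ℓ = 0 := by
  rw [degreeOf_def, Multiset.count_eq_zero]
  intro hmem
  exact hx (by rw [vars_def, Multiset.mem_toFinset]; exact hmem)

/-- **One product gate is multilinear**: affine forms on pairwise disjoint variable sets have a
product with `degreeOf x ≤ 1` for every variable `x` (at most one factor involves `x`).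
[cite: ForbesShpilkaVolk2018, Thm. 9 (syntactic multilinearity)] -/
theorem degreeOf_prod_le_one {n d : ℕ} (ℓ : Fin d → MvPolynomial (Fin n) ℂ)
    (h1 : ∀ i, (ℓ i).totalDegree ≤ 1)
    (hdisj : ∀ i i', i ≠ i' → Disjoint (ℓ i).vars (ℓ i').vars) (x : Fin n) :
    degreeOf x (∏ i, ℓ i) ≤ 1 := by
  classical
  refine (degreeOf_prod_le x _ _).trans ?_
  -- only the factors whose variable set contains `x` contribute, and there is at most one
  have hsplit : ∑ i, (ℓ i).degreeOf x =
      ∑ i ∈ Finset.univ.filter (fun i => x ∈ (ℓ i).vars), (ℓ i).degreeOf x := by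
    rw [Finset.sum_filter]
    refine Finset.sum_congr rfl fun i _ => ?_
    split_ifs with hx
    · rfl
    · exact degreeOf_eq_zero_of_notMem_vars hx
  rw [hsplit]
  have hcard : (Finset.univ.filter (fun i => x ∈ (ℓ i).vars)).card ≤ 1 := by
    refine Finset.card_le_one.2 fun i hi i' hi' => ?_
    rw [Finset.mem_filter] at hi hi'
    by_contra hne
    exact Finset.disjoint_left.1 (hdisj i i' hne) hi.2 hi'.2
  calc ∑ i ∈ Finset.univ.filter (fun i => x ∈ (ℓ i).vars), (ℓ i).degreeOf x
      ≤ ∑ i ∈ Finset.univ.filter (fun i => x ∈ (ℓ i).vars), 1 :=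
        Finset.sum_le_sum fun i _ => (degreeOf_le_totalDegree _ _).trans (h1 i)
    _ ≤ 1 := by rw [Finset.sum_const, smul_eq_mul, mul_one]; exact hcard

/-- A polynomial with `degreeOf x ≤ 1` for all `x` is multilinear (lies in `multilinearSlice`).
[folklore] -/
theorem mem_multilinearSlice_of_degreeOf_le_one {n : ℕ} {f : MvPolynomial (Fin n) ℂ}
    (h : ∀ x, degreeOf x f ≤ 1) : f ∈ multilinearSlice ℂ n :=
  fun _ hm x => (monomial_le_degreeOf x hm).trans (h x)

/-- A multilinear polynomial in `n` variables has total degree `≤ n`. [folklore] -/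
theorem totalDegree_le_of_mem_multilinearSlice {n : ℕ} {f : MvPolynomial (Fin n) ℂ}
    (h : f ∈ multilinearSlice ℂ n) : f.totalDegree ≤ n := by
  rw [totalDegree]
  refine Finset.sup_le fun m hm => ?_
  calc (m.sum fun _ e => e) = ∑ x ∈ m.support, m x := rfl
    _ ≤ ∑ x ∈ m.support, 1 := Finset.sum_le_sum fun x _ => h m hm x
    _ = m.support.card := by rw [Finset.sum_const, smul_eq_mul, mul_one]
    _ ≤ Fintype.card (Fin n) := Finset.card_le_univ _
    _ = n := Fintype.card_fin n

/-- **The bridge.** A multilinear `ΣΠΣ` formula of size `S` (FSV Thm. 9's succinct side,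
`multilinearSPS`) is a multilinear polynomial of total degree `≤ n` and complexity `≤ S(4n+5)`;
hence `multilinearSPS ℂ n S ⊆ SmallCircuits ℂ n b ∩ multilinearSlice ℂ n` when `S(4n+5) ≤ n^b`.
[cite: ForbesShpilkaVolk2018, Thm. 9 and Cor. 5 (= ToC Thm. 1.10, Cor. 1.5)] -/
theorem multilinearSPS_subset_smallCircuits_inter {n S b : ℕ} (hS : S * (4 * n + 5) ≤ n ^ b) :
    multilinearSPS ℂ n S ⊆ SmallCircuits ℂ n b ∩ multilinearSlice ℂ n := by
  rintro f ⟨k, d, ℓ, h1, hdisj, hsize, rfl⟩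
  -- multilinearity
  have hml : (∑ j, ∏ i, ℓ j i) ∈ multilinearSlice ℂ n := by
    refine mem_multilinearSlice_of_degreeOf_le_one fun x => ?_
    refine (degreeOf_sum_le x _ _).trans (Finset.sup_le fun j _ => ?_)
    exact degreeOf_prod_le_one (ℓ j) (h1 j) (hdisj j) x
  refine ⟨⟨totalDegree_le_of_mem_multilinearSlice hml, ?_⟩, hml⟩
  -- complexity: each product gate costs `≤ d_j (4(n+1)) + d_j`, the sum `≤ Σ_j (…) + k`
  have hprod : ∀ j, complexity (∏ i, ℓ j i) ≤ d j * (4 * (n + 1)) + d j := by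
    intro j
    refine (complexity_finset_prod_le _ _).trans ?_
    rw [Finset.card_univ, Fintype.card_fin]
    refine Nat.add_le_add_right ?_ _
    calc ∑ i, complexity (ℓ j i) ≤ ∑ _i : Fin (d j), 4 * (n + 1) :=
          Finset.sum_le_sum fun i _ => complexity_le_of_totalDegree_le_one _ (h1 j i)
      _ = d j * (4 * (n + 1)) := by rw [Finset.sum_const, Finset.card_univ, Fintype.card_fin, smul_eq_mul]
  have hsum : complexity (∑ j, ∏ i, ℓ j i) ≤ (∑ j, (d j * (4 * (n + 1)) + d j)) + k := by
    refine (complexity_finset_sum_le _ _).trans ?_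
    rw [Finset.card_univ, Fintype.card_fin]
    exact Nat.add_le_add_right (Finset.sum_le_sum fun j _ => hprod j) _
  refine hsum.trans (le_trans ?_ hS)
  rw [Finset.sum_add_distrib, ← Finset.sum_mul]
  have hkd : k + ∑ j, d j ≤ S := hsize
  nlinarith

/-! ### Arithmetic of the size regime -/

/-- **Width arithmetic**: for `n ≥ 3` and `s ≤ 2^{n^a}`,
`(⌈log₂ s⌉ + n + 2)^c · (4n+5) ≤ n^{2((a+1)c+2)}`. [folklore] -/
theorem width_arith {n a c s : ℕ} (hn : 3 ≤ n) (hs : s ≤ 2 ^ (n ^ a)) :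
    (Nat.clog 2 s + n + 2) ^ c * (4 * n + 5) ≤ n ^ (2 * ((a + 1) * c + 2)) := by
  have h1 : Nat.clog 2 s ≤ n ^ a := Nat.clog_le_of_le_pow hs
  have hna : 1 ≤ n ^ a := Nat.one_le_pow _ _ (by omega)
  have h2 : Nat.clog 2 s + n + 2 ≤ (n + 3) ^ (a + 1) := by
    have h3 : n ^ a * (n + 3) ≤ (n + 3) ^ a * (n + 3) :=
      Nat.mul_le_mul_right _ (Nat.pow_le_pow_left (by omega) a)
    rw [pow_succ]
    nlinarith
  have h4 : (Nat.clog 2 s + n + 2) ^ c ≤ (n + 3) ^ ((a + 1) * c) := by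
    rw [pow_mul]
    exact Nat.pow_le_pow_left h2 c
  have h5 : 4 * n + 5 ≤ (n + 3) ^ 2 := by nlinarith
  have h6 : (n + 3) ^ ((a + 1) * c + 2) ≤ (n ^ 2) ^ ((a + 1) * c + 2) :=
    Nat.pow_le_pow_left (by nlinarith) _
  calc (Nat.clog 2 s + n + 2) ^ c * (4 * n + 5) ≤ (n + 3) ^ ((a + 1) * c) * (n + 3) ^ 2 :=
        Nat.mul_le_mul h4 h5
    _ = (n + 3) ^ ((a + 1) * c + 2) := by rw [← pow_add]
    _ ≤ (n ^ 2) ^ ((a + 1) * c + 2) := h6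
    _ = n ^ (2 * ((a + 1) * c + 2)) := by rw [← pow_mul]

end Occur

open Occur

/-! ### The consumer theorems (conditional on `FSV2018_thm9_occur`) -/

/-- **Occur-`k` depth-`D` formula distinguishers are hit — multilinear frame, conditionally.**
Assuming the named fact `FSV2018_thm9_occur` (FSV Thm. 9 bullet 6 / Cor. 49), for all `D k a` there
are `b n₀` such that for every `n ≥ n₀` and every size bound `s ≤ 2^{n^a}` the multilinear members
of `SmallCircuits ℂ n b` form a succinct hitting set, with respect to the multilinear monomials, for
the class of distinguishers (polynomials in the `2^n` multilinear coefficient variables) computed by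
size-`≤ s` depth-`≤ D` occur-`≤ k` formulas. Multilinear-frame slice only; the rung's frame
`degLEMonomials` is not reached. [cite: ForbesShpilkaVolk2018, Thm. 9 bullet 6 and Cor. 49 (= ToC Thm. 1.10, Cor. 5.25)] -/
theorem isSuccinctHittingSet_occur (h : FSV2018_thm9_occur) (D k a : ℕ) :
    ∃ b n₀ : ℕ, ∀ n, n₀ ≤ n → ∀ s, s ≤ 2 ^ (n ^ a) →
      IsSuccinctHittingSet (multilinearMonomials n) (SmallCircuits ℂ n b ∩ multilinearSlice ℂ n)
        (occurClass ℂ (multilinearMonomials n) D k s) := by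
  obtain ⟨c, R, hcR⟩ := h D k
  refine ⟨2 * ((a + 1) * c + 2), 3, fun n hn s hs => ?_⟩
  have hhit : MultilinearSPSHits ℂ n ((Nat.clog 2 s + n + 2) ^ c)
      (occurClass ℂ (multilinearMonomials n) D k s) :=
    hcR ℂ n s (Or.inl (ringChar.eq_zero))
  exact hhit.mono (multilinearSPS_subset_smallCircuits_inter (width_arith hn hs)) le_rfl

/-- **No occur-`k` depth-`D` formula natural proofs against the multilinear members of `VP`,
conditionally.** Assuming `FSV2018_thm9_occur`, for all `D k a` there are `b n₀` such that for
`n ≥ n₀`, `b' ≥ b`, `s ≤ 2^{n^a}` and any class `𝒟`, no polynomial computed by a size-`≤ s`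
depth-`≤ D` occur-`≤ k` formula in the multilinear coefficient variables is an algebraically natural
proof against `SmallCircuits ℂ n b' ∩ multilinearSlice ℂ n` (FSV Def. 1 / Thm. 4). Multilinear-frame
slice; the rung stays open. [cite: ForbesShpilkaVolk2018, Def. 1, Thm. 4 and Thm. 9 bullet 6] -/
theorem not_isNaturalProof_occur (h : FSV2018_thm9_occur) (D k a : ℕ) :
    ∃ b n₀ : ℕ, ∀ n, n₀ ≤ n → ∀ b', b ≤ b' → ∀ s, s ≤ 2 ^ (n ^ a) →
      ∀ (𝒟 : Set (MvPolynomial (multilinearMonomials n) ℂ))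
        (Δ : MvPolynomial (multilinearMonomials n) ℂ),
        Δ ∈ occurClass ℂ (multilinearMonomials n) D k s →
          ¬ IsNaturalProof (multilinearMonomials n) (SmallCircuits ℂ n b' ∩ multilinearSlice ℂ n) 𝒟 Δ := by
  obtain ⟨b, n₀, hb⟩ := isSuccinctHittingSet_occur h D k a
  refine ⟨b, n₀ + 1, fun n hn b' hbb' s hs 𝒟 Δ hΔ => ?_⟩
  rintro ⟨-, hΔ0, hvan⟩
  obtain ⟨f, ⟨hf, hfm⟩, hne⟩ := hb n (by omega) s hs Δ hΔ hΔ0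
  exact hne (hvan f ⟨smallCircuits_mono ℂ hbb' (by omega) hf, hfm⟩)

end Summit.ValiantsHypothesis.ValiantsHypothesis.Theorems.BarrierLever.SuccinctHittingSetsForVP

end
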